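import Mathlib
import HarnessLib
import Summits.NavierStokesRegularity.NavierStokesRegularity.Theorems.ZoomReturnDoorRemovableFactors
import Summits.NavierStokesRegularity.NavierStokesRegularity.Theorems.ZoomReturnDoorDoors
import Summits.NavierStokesRegularity.NavierStokesRegularity.Theorems.ZoomReturnDoorBandStability

/-!
# ZoomReturnDoorDoorsHold — S25 «ZoomReturnDoor»: the doors T5⁺ «no small near-one echo» and T6 «restless profile»
# are UNCONDITIONAL tree theorems; the band door T5-band rests on the graded wall alone

With K-band `bandStability_holds` and K-open `removableSetOpen_holds` (`ZoomReturnDoorBandStability`) in place of the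
hypotheses of part 3/4 (`ZoomReturnDoorRemovableFactors`, `ZoomReturnDoorDoors`): the small-echo residue
`smallEchoResidueAt_holds`, **door T5⁺ `targetSmallEcho_holds : TargetSmallEcho`**, **door T6 `targetRestless_holds :
TargetRestless`**, the band door `targetBand_of_removable` (hypothesis: the graded DSS wall on the band, = Tsai Conj. 8.8
restricted to `[a,b]`, PROVED near one by `removable_nearOne`), the structure of the bad factors `exists_minimalBadFactor'`,
`removable_all_of_isOpen_bad'`, and `bandResidue_nearOne'`.  Door texts: part 1 `ZoomReturnDoorDefs` (nsreg-p1 ROUND-24).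
HONEST LABEL: a singularity which is locally space–time Type I cannot have an `ε`-SMALL two-time echo at a ratio near one
through a bounded peephole (T5⁺), nor be «restful» (T6) — unconditional; NS regularity is NOT proved (a Type-I singularity
with no near-echo at all is untouched; the band door away from one meets the wall `TypeIDSSLiouville`).
Lane ns-door-S23-p1 (DIRECTOR-NS #73 (2)); no route, no item.
-/

noncomputable section

set_option linter.dupNamespace false

namespace Summit.NavierStokesRegularity.NavierStokesRegularity.Theorems.ZoomReturnDoorDoorsHold

open Literature.Analysis Literature.Analysis.FluidPDE
open Summit.NavierStokesRegularity.NavierStokesRegularity.Theorems.ZoomReturnDoorDefs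
open Summit.NavierStokesRegularity.NavierStokesRegularity.Theorems.ZoomReturnDoorRemovableFactors
open Summit.NavierStokesRegularity.NavierStokesRegularity.Theorems.ZoomReturnDoorDoors
open Summit.NavierStokesRegularity.NavierStokesRegularity.Theorems.ZoomReturnDoorBandStability

/-- **R-small holds**: the small-echo residue near ratio one, at every viscosity `ν > 0` and decay constant `D`. -/
theorem smallEchoResidueAt_holds {ν : ℝ} (D : ℝ) (hν : 0 < ν) : SmallEchoResidueAt ν D :=
  smallEchoResidueAt_of_bandStability bandStability_holds D hν

/-- **DOOR T5⁺ PROVED, all constants** «no SMALL near-one echo»: for every viscosity and local space–time Type-I constant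
there is a ratio threshold `κ₁ < 1` such that on every band `[a,b] ⊂ (κ₁,1)` and bounded peephole `U` some `ε > 0` makes
an eventually-`ε`-small two-time defect at a ratio in the band incompatible with a singular point. -/
theorem targetSmallEcho_holds : TargetSmallEcho :=
  targetSmallEcho_of_bandStability bandStability_holds

/-- **DOOR T5⁺ at constants `ν, M`** (instance of `targetSmallEcho_holds`). -/
theorem targetSmallEchoAt_holds (ν M : ℝ) (hν : 0 < ν) : TargetSmallEchoAt ν M :=
  targetSmallEcho_holds ν M hν

/-- **DOOR T6 PROVED, all constants** «restless profile». -/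
theorem targetRestless_holds : TargetRestless :=
  targetRestless_of_bandStability bandStability_holds

/-- **DOOR T6 at constants `ν, M`** (instance of `targetRestless_holds`). -/
theorem targetRestlessAt_holds (ν M : ℝ) (hν : 0 < ν) : TargetRestlessAt ν M :=
  targetRestless_holds ν M hν

/-- **THE BAND DOOR T5-band, conditional on the graded wall alone**: if every factor `(√κ)⁻¹`, `κ ∈ [a,b] ⊂ (0,1)`, is
removable at decay `M/ν` (the Type-I DSS Liouville statement for those factors), the band `[a,b]` carries door T5-band at
constants `ν, M` (K-band is now a theorem). -/
theorem targetBand_of_removable {ν M a b : ℝ} (hν : 0 < ν) (ha : 0 < a) (hb : b < 1)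
    (hrem : ∀ κ ∈ Set.Icc a b, RemovableFactor (M / ν) (Real.sqrt κ)⁻¹) : TargetSmallEchoBandAt ν M a b :=
  targetBand_of_bandStability bandStability_holds hν ha hb hrem

/-- **Near-one band residue, unconditional**: for `ν, D > 0` there is `κ₁ ∈ (0,1)` such that every band
`[a,b] ⊂ (κ₁,1)` has the band residue. -/
theorem bandResidue_nearOne' {ν D : ℝ} (hν : 0 < ν) (hD : 0 < D) :
    ∃ κ₁ : ℝ, 0 < κ₁ ∧ κ₁ < 1 ∧ ∀ a b : ℝ, κ₁ < a → b < 1 → BandResidue ν D a b :=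
  bandResidue_nearOne bandStability_holds hν hD

/-- **A minimal bad factor exists** as soon as some factor is not removable (K-open is now a theorem): the bad set is
closed in `(1,∞)` and bounded away from `1` (Chae–Wolf), so it has a least element, below which every factor is removable. -/
theorem exists_minimalBadFactor' {D : ℝ} (hD : 0 < D) (hbad : ∃ c : ℝ, 1 < c ∧ ¬ RemovableFactor D c) :
    ∃ cm : ℝ, 1 < cm ∧ ¬ RemovableFactor D cm ∧ ∀ c : ℝ, 1 < c → c < cm → RemovableFactor D c :=
  exists_minimalBadFactor removableSetOpen_holds hD hbad

/-- **Connectedness dichotomy, unconditional in K-open**: if the bad set `{c > 1 | ¬ RemovableFactor D c}` is also open,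
then EVERY factor is removable at decay `D` (`(1,∞)` is connected and the removable set is open, nonempty near `1`). -/
theorem removable_all_of_isOpen_bad' {D : ℝ} (hD : 0 < D)
    (hbad : IsOpen {c : ℝ | 1 < c ∧ ¬ RemovableFactor D c}) : ∀ c : ℝ, 1 < c → RemovableFactor D c :=
  removable_all_of_isOpen_bad removableSetOpen_holds hD hbad

end Summit.NavierStokesRegularity.NavierStokesRegularity.Theorems.ZoomReturnDoorDoorsHold

end
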